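import Mathlib.RepresentationTheory.Homological.ContCohomology.Functoriality
import Mathlib.Tactic.Group
import HarnessLib

/-!
# [AbsTopIII] Prop. 1.4 (ii) / Prop. 1.6 (iii): low-degree tools for Mathlib's continuous cohomology
# (classes of continuous homomorphisms in `H¹`, the alternation functional on `H²`)

Mochizuki, *Topics in Absolute Anabelian Geometry III*, §1 (manuscript pages, lit key
`paper:url-5493eb38cbb7`): Prop. 1.4 (ii) p. 31 ("`M_X := Hom(H²(Δ_X, Ẑ), Ẑ)`", the intrinsic cyclotome)
and Prop. 1.6 (iii) p. 35 ("restricting cohomology classes of `Π_U` to the various `I_x` [...] yields a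
natural exact sequence `1 → (k^×)^∧ → H¹(Π_U, M_X) → ⊕_{x ∈ S} Ẑ`").  The tree realises `H²(Δ_X, Λ)`
and `H¹(Π_U, M_X(Λ))` by Mathlib's `continuousCohomology` (homology of the complex of homogeneous
continuous cochains `C(G, C(G, ⋯))^G`, `Mathlib.RepresentationTheory.Homological.ContCohomology`), for
which Mathlib provides only `H⁰ ≅ invariants`.  This PROOF-ONLY file (no definition; cell abc-iut,
FACT-LIST row F-0378, seat abc-iut-f-085) supplies the two element-level tools in degrees one and two
that make these groups COMPUTABLE enough to decide the universal closures of the §1 schema rows: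

* `exists_desc_of_d_comp_eq_zero`, `apply_iCycles_eq_zero_of_homologyπ_eq_zero` — a continuous linear
  map on `Kⁿ⁺¹` killing `d(Kⁿ)` descends to `Hⁿ⁺¹` (Mathlib's `homology` in `TopModuleCat` is the
  cokernel of `Kⁿ → Zⁿ⁺¹`); `exists_cycles_of_d_apply_eq_zero` — a cochain killed by `d` is a cocycle;
* `d_one_apply`, `d_two_apply`, `d_three_apply`, `mem_invariants_{one,two,three}_iff` — the differentials
  and the invariance (homogeneity) conditions of the standard resolution in closed form;
* `exists_H1_class_of_trivial_action` — for a TRIVIAL action, a continuous additive `φ : G → A` defines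
  `η_φ ∈ H¹(G, A)` (cocycle `(x, y) ↦ φ(x⁻¹y)`), and the restriction of `η_φ` along `ι : H → G` vanishes
  only if `φ ∘ ι = 0` (evaluation `F ↦ F(1)(h)` kills the coboundaries);
* `exists_H2_functional_of_trivial_action` — for a trivial action, a continuous bi-additive
  `χ : G × G → A` and commuting `x₀, y₀`: the alternation `Φ ↦ Φ(1,x₀,x₀y₀) - Φ(1,y₀,y₀x₀)` descends to a
  continuous linear `H²(G, A) → A` whose value on the class of `(x, y, z) ↦ χ(x⁻¹y, y⁻¹z)` is
  `χ(x₀,y₀) - χ(y₀,x₀)` — the certificate of a NONTRIVIAL cyclotome used by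
  `GeometricCyclotomeNontrivial.lean` / `KummerPUKerClosureRefutation.lean`.

Pure Mathlib-level statements (any coefficient ring `k`, any topological group); HONEST FRAMING: nothing
here bears on [IUTchIII] Cor. 3.12.
-/

noncomputable section

open CategoryTheory ContRepresentation TopRep

namespace Literature.AnabelianGeometry.AbsoluteAnabelian.AbsTopIII

namespace ContCohomologyTools

section General

variable {k : Type*} [Ring k] [TopologicalSpace k]

/-- In a cochain complex of topological modules, a continuous linear map on `Kⁿ⁺¹` that kills the
coboundaries `d(Kⁿ)` descends to the cohomology `Hⁿ⁺¹` (Mathlib's homology is the cokernel of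
`Kⁿ → Zⁿ⁺¹`), compatibly with the projection from cocycles. [cite: MochizukiAbsTopIII2015, Prop 1.4 (ii) p.31] -/
theorem exists_desc_of_d_comp_eq_zero (K : CochainComplex (TopModuleCat k) ℕ) (n : ℕ)
    {T : TopModuleCat k} (τ : K.X (n + 1) ⟶ T) (hτ : K.d n (n + 1) ≫ τ = 0) :
    ∃ τ' : K.homology (n + 1) ⟶ T,
      ∀ z : K.cycles (n + 1), τ' (K.homologyπ (n + 1) z) = τ (K.iCycles (n + 1) z) := by
  have hf : (K.sc (n + 1)).f ≫ τ = 0 := by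
    change K.d ((ComplexShape.up ℕ).prev (n + 1)) (n + 1) ≫ τ = 0
    rw [CochainComplex.prev_nat_succ]
    exact hτ
  have hk : (K.sc (n + 1)).toCycles ≫ ((K.sc (n + 1)).iCycles ≫ τ) = 0 := by
    rw [← Category.assoc, ShortComplex.toCycles_i, hf]
  refine ⟨(K.sc (n + 1)).descHomology _ hk, fun z => ?_⟩
  have hπ := (K.sc (n + 1)).π_descHomology _ hk
  have happ := ConcreteCategory.congr_hom hπ z
  simp only [ConcreteCategory.comp_apply] at happ
  exact happ

/-- In a cochain complex of topological modules, a continuous linear map on `Kⁿ⁺¹` that kills the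
coboundaries vanishes on every cocycle whose cohomology class is zero.
[cite: MochizukiAbsTopIII2015, Prop 1.4 (ii) p.31] -/
theorem apply_iCycles_eq_zero_of_homologyπ_eq_zero (K : CochainComplex (TopModuleCat k) ℕ) (n : ℕ)
    {T : TopModuleCat k} (τ : K.X (n + 1) ⟶ T) (hτ : K.d n (n + 1) ≫ τ = 0)
    (z : K.cycles (n + 1)) (hz : K.homologyπ (n + 1) z = 0) :
    τ (K.iCycles (n + 1) z) = 0 := by
  obtain ⟨τ', hτ'⟩ := exists_desc_of_d_comp_eq_zero K n τ hτ
  rw [← hτ' z, hz]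
  exact map_zero _

/-- An element of `Kⁿ` killed by `d` defines a cocycle (an element of Mathlib's `K.cycles n`)
with that underlying cochain. [cite: MochizukiAbsTopIII2015, Prop 1.4 (ii) p.31] -/
theorem exists_cycles_of_d_apply_eq_zero (K : CochainComplex (TopModuleCat k) ℕ) (n : ℕ)
    (σ : K.X n) (hσ : K.d n (n + 1) σ = 0) : ∃ z : K.cycles n, K.iCycles n z = σ := by
  have hmem : σ ∈ (K.d n (n + 1)).hom.ker := hσ
  refine ⟨K.liftCycles (TopModuleCat.kerι (K.d n (n + 1))) (n + 1) (by simp)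
    (TopModuleCat.kerι_comp _) (⟨σ, hmem⟩ : (K.d n (n + 1)).hom.ker), ?_⟩
  have h := K.liftCycles_i (TopModuleCat.kerι (K.d n (n + 1))) (n + 1) (by simp)
    (TopModuleCat.kerι_comp _)
  have happ := ConcreteCategory.congr_hom h (⟨σ, hmem⟩ : (K.d n (n + 1)).hom.ker)
  simp only [ConcreteCategory.comp_apply] at happ
  rw [happ]
  rfl

end General

section LowDegree

variable {k : Type*} [Ring k] [TopologicalSpace k]
variable {G : Type*} [Group G] [TopologicalSpace G] [IsTopologicalGroup G]
variable (A : TopRep k G)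

/-- The differential `C(G, A) → C(G, C(G, A))` of Mathlib's standard resolution:
`(d f)(x)(y) = f(y) - f(x)`. [cite: MochizukiAbsTopIII2015, Prop 1.4 (ii) p.31] -/
theorem d_one_apply (f : C(G, A)) (x y : G) : (TopRep.d A 1).hom f x y = f y - f x := by
  simp [TopRep.d_succ, TopRep.d_zero, TopRep.hom_sub, ContIntertwiningMap.sub_apply,
    ContRepresentation.coind₁ι_toFun, ContRepresentation.coind₁Map_toFun]

/-- The differential `C(G, C(G, A)) → C(G, C(G, C(G, A)))` of Mathlib's standard resolution:
`(d F)(x)(y)(z) = F(y)(z) - F(x)(z) + F(x)(y)`. [cite: MochizukiAbsTopIII2015, Prop 1.4 (ii) p.31] -/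
theorem d_two_apply (F : C(G, C(G, A))) (x y z : G) :
    (TopRep.d A 2).hom F x y z = F y z - (F x z - F x y) := by
  simp [TopRep.d_succ, TopRep.d_zero, TopRep.hom_sub, ContIntertwiningMap.sub_apply,
    ContRepresentation.coind₁ι_toFun, ContRepresentation.coind₁Map_toFun]

/-- The differential in degree three of Mathlib's standard resolution:
`(d Φ)(w)(x)(y)(z) = Φ(x,y,z) - Φ(w,y,z) + Φ(w,x,z) - Φ(w,x,y)`.
[cite: MochizukiAbsTopIII2015, Prop 1.4 (ii) p.31] -/
theorem d_three_apply (Φ : C(G, C(G, C(G, A)))) (w x y z : G) :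
    (TopRep.d A 3).hom Φ w x y z = Φ x y z - (Φ w y z - (Φ w x z - Φ w x y)) := by
  simp [TopRep.d_succ, TopRep.d_zero, TopRep.hom_sub, ContIntertwiningMap.sub_apply,
    ContRepresentation.coind₁ι_toFun, ContRepresentation.coind₁Map_toFun]

/-- Invariance in `C(G, A)` under the coinduced action: `g · f(g⁻¹ x) = f(x)`.
[cite: MochizukiAbsTopIII2015, Prop 1.4 (ii) p.31] -/
theorem mem_invariants_one_iff (f : C(G, A)) :
    f ∈ (TopRep.resolutionX A 1).ρ.invariants ↔ ∀ g x, A.ρ g (f (g⁻¹ * x)) = f x := by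
  simp only [ContRepresentation.mem_invariants]
  constructor
  · intro h g x
    have := congrArg (fun (H : C(G, A)) => H x) (h g)
    simpa [ContRepresentation.coind₁_apply_apply] using this
  · intro h g
    ext x
    simpa [ContRepresentation.coind₁_apply_apply] using h g x

/-- Invariance in `C(G, C(G, A))` under the coinduced action: `g · F(g⁻¹ x)(g⁻¹ y) = F(x)(y)`
(homogeneous cochains). [cite: MochizukiAbsTopIII2015, Prop 1.4 (ii) p.31] -/
theorem mem_invariants_two_iff (F : C(G, C(G, A))) :
    F ∈ (TopRep.resolutionX A 2).ρ.invariants ↔ ∀ g x y, A.ρ g (F (g⁻¹ * x) (g⁻¹ * y)) = F x y := by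
  simp only [ContRepresentation.mem_invariants]
  constructor
  · intro h g x y
    have := congrArg (fun (H : C(G, C(G, A))) => H x y) (h g)
    simpa [ContRepresentation.coind₁_apply_apply] using this
  · intro h g
    ext x y
    simpa [ContRepresentation.coind₁_apply_apply] using h g x y

/-- Invariance in `C(G, C(G, C(G, A)))` under the coinduced action.
[cite: MochizukiAbsTopIII2015, Prop 1.4 (ii) p.31] -/
theorem mem_invariants_three_iff (Φ : C(G, C(G, C(G, A)))) :
    Φ ∈ (TopRep.resolutionX A 3).ρ.invariants ↔
      ∀ g x y z, A.ρ g (Φ (g⁻¹ * x) (g⁻¹ * y) (g⁻¹ * z)) = Φ x y z := by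
  simp only [ContRepresentation.mem_invariants]
  constructor
  · intro h g x y z
    have := congrArg (fun (H : C(G, C(G, C(G, A)))) => H x y z) (h g)
    simpa [ContRepresentation.coind₁_apply_apply] using this
  · intro h g
    ext x y z
    simpa [ContRepresentation.coind₁_apply_apply] using h g x y z

/-- **`Hom_cont(G, A) → H¹(G, A)` detects restrictions, for a trivial action.**  For a topological
group `G` acting trivially on `A` and a continuous additive map `φ : G → A`, the homogeneous
`1`-cocycle `(x, y) ↦ φ(x⁻¹y)` defines a class `η ∈ H¹(G, A)` (Mathlib's continuous cohomology) whose
restriction along any continuous homomorphism `ι : H → G` vanishes only if `φ ∘ ι = 0` (the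
coboundaries of a trivial module vanish in degree one; evaluation `F ↦ F(1)(h)` is a continuous
functional on cochains killing them). [cite: MochizukiAbsTopIII2015, Prop 1.6 (iii) p.35] -/
theorem exists_H1_class_of_trivial_action (hA : ∀ (g : G) (v : A), A.ρ g v = v) (φ : C(G, A))
    (hφ : ∀ x y, φ (x * y) = φ x + φ y) :
    ∃ η : continuousCohomology 1 A,
      ∀ {H : Type _} [Group H] [TopologicalSpace H] [IsTopologicalGroup H] (ι : H →ₜ* G),
        ContinuousCohomology.map ι (𝟙 (TopRep.res (ι : H →* G) A)) 1 η = 0 → ∀ h, φ (ι h) = 0 := by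
  -- the homogeneous 1-cochain
  let σ : C(G, C(G, A)) :=
    ContinuousMap.curry ⟨fun p : G × G => φ (p.1⁻¹ * p.2), by fun_prop⟩
  have hσapp : ∀ x y, σ x y = φ (x⁻¹ * y) := fun _ _ => rfl
  have hσinv : σ ∈ (TopRep.resolutionX A 2).ρ.invariants := by
    rw [mem_invariants_two_iff]
    intro g x y
    rw [hA, hσapp, hσapp]
    congr 1
    group
  let σ' : (homogeneousCochains A).X 1 := ⟨σ, hσinv⟩
  have hd : (homogeneousCochains A).d 1 2 σ' = 0 := by
    -- compare underlying cochains (the terms of `homogeneousCochains A` are invariant submodules)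
    apply Subtype.ext
    refine (homogeneousCochains.d_apply A 1 σ').trans ?_
    ext x y z
    change (TopRep.d A 2).hom σ x y z = 0
    rw [d_two_apply, hσapp, hσapp, hσapp,
      show x⁻¹ * z = (x⁻¹ * y) * (y⁻¹ * z) by group, hφ (x⁻¹ * y) (y⁻¹ * z)]
    abel
  obtain ⟨zc, hzc⟩ := exists_cycles_of_d_apply_eq_zero (homogeneousCochains A) 1 σ' hd
  refine ⟨(homogeneousCochains A).homologyπ 1 zc, ?_⟩
  intro H _ _ _ ι hzero h
  -- the restricted representation and its complex
  let B : TopRep k H := TopRep.res (ι : H →* G) A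
  have hB : ∀ (g : H) (v : B), B.ρ g v = v := fun g v => hA (ι g) v
  -- naturality of `π`
  have hnat := ContinuousCohomology.π_map ι (𝟙 B) 1
  have hnat' := ConcreteCategory.congr_hom hnat zc
  simp only [ConcreteCategory.comp_apply] at hnat'
  have hw : (homogeneousCochains B).homologyπ 1
      (ContinuousCohomology.cocyclesMap ι (𝟙 B) 1 zc) = 0 := by
    change (ContinuousCohomology.π B 1) (ContinuousCohomology.cocyclesMap ι (𝟙 B) 1 zc) = 0
    rw [← hnat']
    exact hzero
  -- the evaluation functional `F ↦ F(1)(h)` on `1`-cochains of `B`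
  let τ : (homogeneousCochains B).X 1 ⟶ TopModuleCat.of k B :=
    TopModuleCat.ofHom
      { toFun := fun F => (F.1 : C(H, C(H, B))) 1 h
        map_add' := fun _ _ => rfl
        map_smul' := fun _ _ => rfl
        cont := (continuous_eval_const h).comp
          ((continuous_eval_const (1 : H)).comp continuous_subtype_val) }
  have hτ : (homogeneousCochains B).d 0 1 ≫ τ = 0 := by
    ext f
    change (TopModuleCat.Hom.hom τ) (((homogeneousCochains B).d 0 (0 + 1)) f) = 0
    have hf : ∀ g x, (f.1 : C(H, B)) (g⁻¹ * x) = (f.1 : C(H, B)) x := by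
      intro g x
      have := (mem_invariants_one_iff B (f.1 : C(H, B))).1 f.2 g x
      rwa [hB] at this
    have hval : ((((homogeneousCochains B).d 0 (0 + 1)) f).1 : C(H, C(H, B))) =
        (TopRep.d B 1).hom (f.1 : C(H, B)) :=
      homogeneousCochains.d_apply B 0 f
    change ((((homogeneousCochains B).d 0 (0 + 1)) f).1 : C(H, C(H, B))) 1 h = 0
    rw [hval, d_one_apply]
    have := hf h h
    rw [inv_mul_cancel] at this
    rw [← this, sub_self]
  have hvan := apply_iCycles_eq_zero_of_homologyπ_eq_zero (homogeneousCochains B) 0 τ hτ _ hw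
  -- compute the functional on the restricted cocycle
  have hi : (homogeneousCochains B).iCycles 1 (ContinuousCohomology.cocyclesMap ι (𝟙 B) 1 zc) =
      (ContinuousCohomology.cochainsMap ι (𝟙 B)).f 1 σ' := by
    have := HomologicalComplex.cyclesMap_i (ContinuousCohomology.cochainsMap ι (𝟙 B)) 1
    have h' := ConcreteCategory.congr_hom this zc
    simp only [ConcreteCategory.comp_apply] at h'
    rw [← hzc]
    exact h'
  rw [hi] at hvan
  change ((((ContinuousCohomology.cochainsMap ι (𝟙 B)).f 1) σ').1 : C(H, C(H, B))) 1 h = 0 at hvan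
  rw [ContinuousCohomology.cochainsMap_f] at hvan
  change σ (ι 1) (ι h) = 0 at hvan
  rwa [hσapp, map_one, inv_one, one_mul] at hvan

/-- **A continuous linear functional on `H²(G, A)` for a trivial action, and its value on a
bi-additive cocycle.**  For a topological group `G` acting trivially on `A`, a continuous
bi-additive map `χ : G × G → A` and commuting elements `x₀, y₀ ∈ G`: the homogeneous `2`-cochain
`(x, y, z) ↦ χ(x⁻¹y, y⁻¹z)` is a cocycle, the "alternation" functional
`Φ ↦ Φ(1, x₀, x₀y₀) - Φ(1, y₀, y₀x₀)` kills the coboundaries (because `x₀y₀ = y₀x₀` and `1`-cochains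
are `G`-invariant), hence descends to a continuous linear map `H²(G, A) → A` (Mathlib's continuous
cohomology), and its value on the class of that cocycle is `χ(x₀, y₀) - χ(y₀, x₀)`.  (This is how a
NONTRIVIAL `Hom(H²(Δ, Ẑ), Ẑ)` is certified below.) [cite: MochizukiAbsTopIII2015, Prop 1.4 (ii) p.31] -/
theorem exists_H2_functional_of_trivial_action (hA : ∀ (g : G) (v : A), A.ρ g v = v)
    (χ : C(G × G, A)) (hχ₁ : ∀ x y z, χ (x * y, z) = χ (x, z) + χ (y, z))
    (hχ₂ : ∀ x y z, χ (x, y * z) = χ (x, y) + χ (x, z)) (x₀ y₀ : G) (hcomm : x₀ * y₀ = y₀ * x₀) :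
    ∃ (ξ : continuousCohomology 2 A) (τ : continuousCohomology 2 A ⟶ TopModuleCat.of k A),
      τ ξ = χ (x₀, y₀) - χ (y₀, x₀) := by
  -- the homogeneous 2-cochain
  let ψ : C((G × G) × G, A) :=
    ⟨fun p => χ (p.1.1⁻¹ * p.1.2, p.1.2⁻¹ * p.2), by fun_prop⟩
  let Φ : C(G, C(G, C(G, A))) := ψ.curry.curry
  have hΦapp : ∀ x y z, Φ x y z = χ (x⁻¹ * y, y⁻¹ * z) := fun _ _ _ => rfl
  have hΦinv : Φ ∈ (TopRep.resolutionX A 3).ρ.invariants := by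
    rw [mem_invariants_three_iff]
    intro g x y z
    rw [hA, hΦapp, hΦapp, show (g⁻¹ * x)⁻¹ * (g⁻¹ * y) = x⁻¹ * y by group,
      show (g⁻¹ * y)⁻¹ * (g⁻¹ * z) = y⁻¹ * z by group]
  let Φ' : (homogeneousCochains A).X 2 := ⟨Φ, hΦinv⟩
  have hd : (homogeneousCochains A).d 2 3 Φ' = 0 := by
    -- compare underlying cochains (the terms of `homogeneousCochains A` are invariant submodules)
    apply Subtype.ext
    refine (homogeneousCochains.d_apply A 2 Φ').trans ?_
    ext w x y z
    change (TopRep.d A 3).hom Φ w x y z = 0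
    rw [d_three_apply, hΦapp, hΦapp, hΦapp, hΦapp,
      show w⁻¹ * y = (w⁻¹ * x) * (x⁻¹ * y) by group,
      show x⁻¹ * z = (x⁻¹ * y) * (y⁻¹ * z) by group,
      hχ₁ (w⁻¹ * x) (x⁻¹ * y) (y⁻¹ * z), hχ₂ (w⁻¹ * x) (x⁻¹ * y) (y⁻¹ * z)]
    abel
  obtain ⟨zc, hzc⟩ := exists_cycles_of_d_apply_eq_zero (homogeneousCochains A) 2 Φ' hd
  -- the alternation functional on 2-cochains
  let τ₀ : (homogeneousCochains A).X 2 ⟶ TopModuleCat.of k A :=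
    TopModuleCat.ofHom
      { toFun := fun F => (F.1 : C(G, C(G, C(G, A)))) 1 x₀ (x₀ * y₀) -
          (F.1 : C(G, C(G, C(G, A)))) 1 y₀ (y₀ * x₀)
        map_add' := fun F F' => by
          change ((F.1 : C(G, C(G, C(G, A)))) 1 x₀ (x₀ * y₀) + (F'.1 : C(G, C(G, C(G, A)))) 1 x₀ (x₀ * y₀)) -
            ((F.1 : C(G, C(G, C(G, A)))) 1 y₀ (y₀ * x₀) + (F'.1 : C(G, C(G, C(G, A)))) 1 y₀ (y₀ * x₀)) = _
          exact add_sub_add_comm _ _ _ _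
        map_smul' := fun c F => by
          change c • (F.1 : C(G, C(G, C(G, A)))) 1 x₀ (x₀ * y₀) -
            c • (F.1 : C(G, C(G, C(G, A)))) 1 y₀ (y₀ * x₀) = _
          rw [← smul_sub]
          rfl
        cont := (((continuous_eval_const (x₀ * y₀)).comp ((continuous_eval_const x₀).comp
            ((continuous_eval_const (1 : G)).comp continuous_subtype_val))).sub
          ((continuous_eval_const (y₀ * x₀)).comp ((continuous_eval_const y₀).comp
            ((continuous_eval_const (1 : G)).comp continuous_subtype_val)))) }
  have hτ₀app : ∀ F : (homogeneousCochains A).X 2,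
      τ₀ F = (F.1 : C(G, C(G, C(G, A)))) 1 x₀ (x₀ * y₀) - (F.1 : C(G, C(G, C(G, A)))) 1 y₀ (y₀ * x₀) :=
    fun _ => rfl
  have hτ : (homogeneousCochains A).d 1 2 ≫ τ₀ = 0 := by
    ext F
    change τ₀ (((homogeneousCochains A).d 1 (1 + 1)) F) = 0
    rw [hτ₀app]
    have hF : ∀ g x y, (F.1 : C(G, C(G, A))) (g⁻¹ * x) (g⁻¹ * y) = (F.1 : C(G, C(G, A))) x y := by
      intro g x y
      have := (mem_invariants_two_iff A (F.1 : C(G, C(G, A)))).1 F.2 g x y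
      rwa [hA] at this
    have hval : ((((homogeneousCochains A).d 1 (1 + 1)) F).1 : C(G, C(G, C(G, A)))) =
        (TopRep.d A 2).hom (F.1 : C(G, C(G, A))) :=
      homogeneousCochains.d_apply A 1 F
    rw [hval, d_two_apply, d_two_apply]
    have h1 := hF x₀ x₀ (x₀ * y₀)
    rw [inv_mul_cancel, inv_mul_cancel_left] at h1
    have h2 := hF y₀ y₀ (y₀ * x₀)
    rw [inv_mul_cancel, inv_mul_cancel_left] at h2
    rw [← h1, ← h2, ← hcomm]
    abel
  obtain ⟨τ', hτ'⟩ := exists_desc_of_d_comp_eq_zero (homogeneousCochains A) 1 τ₀ hτ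
  refine ⟨(homogeneousCochains A).homologyπ 2 zc, τ', ?_⟩
  rw [hτ' zc, hzc, hτ₀app]
  change Φ 1 x₀ (x₀ * y₀) - Φ 1 y₀ (y₀ * x₀) = _
  rw [hΦapp, hΦapp]
  simp only [inv_one, one_mul, inv_mul_cancel_left]

end LowDegree

end ContCohomologyTools

end Literature.AnabelianGeometry.AbsoluteAnabelian.AbsTopIII
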